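/-
Copyright (c) 2026 the pub-hodgecm-mathlib formalisation cell (harness21).  Prover seat hodgecm-mathlib-F0P2-p09 (g3) on chair-VALVE loan to section S6 of the R90-TF
programme (S6 dealer R90-C14-plan (g2) «take §3» 2026-09-05T02:31:48Z, «counts pair stays in your file» 02:44:28Z; chair K2-lead (g2) VALVE 19); crux H413 (`stmt-HodgeConjecture-24833`).
THEOREMS ONLY (no `def`, no `instance`, no notation, no named-fact hypothesis, no `sorry`).
-/
import Summits.HodgeConjecture.HodgeConjecture.Theorems.R90S6TorusFixedSpecialCountResiduallySeparated  -- ★ R-III rung `natCard_fixedBy_special_add_eq_one_of_residually_separated` (a₁ + a₀ = 1)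
import Summits.HodgeConjecture.HodgeConjecture.Theorems.R90S6FlickerLiteralFrames                     -- ★ FILE A: Fix letters `flickerFrame_one_mem_fixedBy`, `flickerFrame_weyl_mem_fixedBy`
import HarnessLib

/-!
# R90 · S6 — §3 of CARD (m2), FILE B: THE FIXED-VERTEX COUNTS OF FLICKER'S LITERALS IN REGIME R-III — `(V_hyp, V_sp)(t₁) = (1, 0)`, `(V_hyp, V_sp)(t_ϖ) = (0, 1)`
# (`Theorems/R90S6FlickerLiteralCounts.lean`)

Cell `hodgecm-mathlib`, crux H413 (`stmt-HodgeConjecture-24833`), route of record `HCCMUnconditional`; programme R90-TF, section S6 (base `R90-C14`); S6 dealer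
R90-C14-plan (g2) 02:44:28Z «the counts pair stays in your file; GF1 FILE 2b (R90-C14-p10 (g2)) imports them by name»; consumers GF1 FILE 2a (K2Liu-p14 (g5)) ∕ 2b (R90-C14-p10 (g2));
helper lane `--supports stmt-HodgeConjecture-24833 --as helper`.  Sibling of ★ FILE A `R90S6FlickerLiteralFrames` (split by the 400-line rule).

THE MATHEMATICS.  In regime R-III (the eigenvalues `a, b, c ∈ K¹` pairwise residually separated) the ★ R-III rung `natCard_fixedBy_special_add_eq_one_of_residually_separated`
(`R90S6TorusFixedSpecialCountResiduallySeparated`) gives `a₁ + a₀ = 1` for every `γ ∈ U` with `charpoly γ ≡ (X − a)(X − b)(X − c)` — the case of all four Flicker literals (★ (m2)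
`flickerLiteral_charpoly_letter_separated` over ★ `charpoly_flickerTorusElt`).  WHICH of `(a₀, a₁) = (#Fix(U⧸K₀), #Fix(U⧸K₁))` is `1` is the literal-dependent datum of ★ FILE A:
`t₁ ∈ K₀` fixes the root coset (`flickerFrame_one_mem_fixedBy`) ⇒ **`(a₀, a₁)(t₁) = (1, 0)`**; `t_ϖ(a,b,c)` fixes the special coset `w₀·K₁` (`flickerFrame_weyl_mem_fixedBy`, `w₀ =
antidiag(1,1,1) =` ★ `weylLongU`) ⇒ **`(a₀, a₁)(t_ϖ) = (0, 1)`** — Flicker's «`t₁` is `K`-conjugate into `K = K₀`, `t₂, t₃, t₄` are not» read on the tree.  The rung's binders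
`hd g₁ hg₁ γ [Fintype …] hK₁fin horb r hr [∀ x, Finite …]` are carried VERBATIM; `t₃ = t_ϖ(a,c,b)`, `t₄ = t_ϖ(b,a,c)` are the `t_ϖ` head with the letters permuted.
[Flicker1998UnitaryFL, §2 Prop. 3 pp. 78–79; §3 p. 80] [Kottwitz1986BaseChangeUnits, §1 pp. 240–242] [Rogawski1990, §4.9 pp. 54–56] [Serre1980Trees, I.6.1, II.1.1].
HONEST LABEL: per-literal plug-ins over ★ organs; pays no rung and no printed statement by itself; count-neutral.  HC_CM is proved only modulo the 7 printed citations
(2 remaining named inputs: hLiu418 = `stmt-HodgeConjecture-24832`, h413 = `stmt-HodgeConjecture-24833`) until rung 0 closes.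

## References
* [Flicker1998UnitaryFL] Y. Z. Flicker, *Elementary proof of the fundamental lemma for a unitary group*, Canad. J. Math. 50 (1998) 74–98: §2 Prop. 3 pp. 78–79, §3 p. 80.
* [Kottwitz1986BaseChangeUnits] R. E. Kottwitz, *Base change for unit elements of Hecke algebras*, Compositio Math. 60 (1986) 237–250: §1 pp. 240–242.
* [Rogawski1990] J. D. Rogawski, *Automorphic Representations of Unitary Groups in Three Variables*, Ann. of Math. Stud. 123 (1990): §4.9 pp. 54–56.
* [Serre1980Trees] J.-P. Serre, *Trees* (1980): I.6.1, II.1.1.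
-/

set_option autoImplicit false
-- the mandated namespace repeats the single-problem summit's segment (`HodgeConjecture.HodgeConjecture`)
set_option linter.dupNamespace false

noncomputable section

open MulAction Polynomial
open Literature.NumberTheory.Automorphic Literature.NumberTheory.Automorphic.HermitianLattice Literature.NumberTheory.Automorphic.UnitaryGroup
open Literature.NumberTheory.Automorphic.UnitaryLatticeTree Literature.NumberTheory.Rogawski1990
open scoped Matrix MatrixGroups WithZero Valued

namespace Summit.HodgeConjecture.HodgeConjecture.R90.S6

variable {K : Type*} [Field K] [Valued K ℤᵐ⁰] [ValuativeRel K] [(Valued.v : Valuation K ℤᵐ⁰).Compatible]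


-- the quotient-action instances `MulAction ↥K₀ (↥K₀ ⧸ I.subgroupOf K₀)` inside the ★ rung's binders exceed the default synthesis budget (same options as the ★ rung file)
set_option synthInstance.maxHeartbeats 400000 in
set_option maxHeartbeats 1600000 in
/-- **`(V_hyp, V_sp)(t₁) = (1, 0)` IN REGIME R-III.**  In the letters of the ★ R-III rung `natCard_fixedBy_special_add_eq_one_of_residually_separated` (its binders
`hd g₁ hg₁ γ [Fintype …] hK₁fin horb r hr [∀ x, Finite …]` VERBATIM), for the literal `γ = t₁(a,b,c)` with norm-one, pairwise residually separated `a, b, c` and `|2| = 1`: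
`#Fix_γ(U ⧸ K₀) = 1` and `#Fix_γ(U ⧸ K₁) = 0` — the rung gives `a₁ + a₀ = 1` (★ (m2) letters `flickerLiteral_normOne_letters` ∕ `_separated_letters_iff` ∕ `_charpoly_letter_separated`
over ★ `charpoly_flickerTorusElt`), and the root coset is fixed (`flickerFrame_one_mem_fixedBy`). [cite: Flicker1998UnitaryFL, §2 Prop. 3 pp. 78–79] [cite: Kottwitz1986BaseChangeUnits, §1 p. 241]
[cite: Serre1980Trees, I.6.1] -/
theorem flickerFrame_natCard_fixedBy_one_of_separated
    {σ : K →+* K} {ϖ : K} (hd : UnramifiedLocalConjDatum σ ϖ)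
    (g₁ : GL (Fin 3) K) (hg₁ : (g₁ : Matrix (Fin 3) (Fin 3) K) = Matrix.diagonal ![(1 : K), 1, ϖ])
    (γ : ↥(unitaryGroupOfForm σ ((StdForm.antidiagonal 3).over K)))
    [Fintype (fixedBy (↥(unitaryGroupOfForm σ ((StdForm.antidiagonal 3).over K)) ⧸ (glInt 3 K).subgroupOf (unitaryGroupOfForm σ ((StdForm.antidiagonal 3).over K))) γ)]
    (hK₁fin : (fixedBy (↥(unitaryGroupOfForm σ ((StdForm.antidiagonal 3).over K)) ⧸ ((glInt 3 K).map (MulAut.conj g₁).toMonoidHom).subgroupOf (unitaryGroupOfForm σ ((StdForm.antidiagonal 3).over K))) γ).Finite)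
    (horb : (Set.range fun n : ℕ => ((γ ^ n : ↥(unitaryGroupOfForm σ ((StdForm.antidiagonal 3).over K))) : ↥(unitaryGroupOfForm σ ((StdForm.antidiagonal 3).over K)) ⧸ (glInt 3 K).subgroupOf (unitaryGroupOfForm σ ((StdForm.antidiagonal 3).over K)))).Finite)
    (r : ↥(unitaryGroupOfForm σ ((StdForm.antidiagonal 3).over K)) ⧸ (glInt 3 K).subgroupOf (unitaryGroupOfForm σ ((StdForm.antidiagonal 3).over K)) → ↥(unitaryGroupOfForm σ ((StdForm.antidiagonal 3).over K)))
    (hr : Function.RightInverse r QuotientGroup.mk)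
    [∀ x : fixedBy (↥(unitaryGroupOfForm σ ((StdForm.antidiagonal 3).over K)) ⧸ (glInt 3 K).subgroupOf (unitaryGroupOfForm σ ((StdForm.antidiagonal 3).over K))) γ,
      Finite (fixedBy (↥((glInt 3 K).subgroupOf (unitaryGroupOfForm σ ((StdForm.antidiagonal 3).over K))) ⧸
        (((glInt 3 K).subgroupOf (unitaryGroupOfForm σ ((StdForm.antidiagonal 3).over K)) ⊓ ((glInt 3 K).map (MulAut.conj g₁).toMonoidHom).subgroupOf (unitaryGroupOfForm σ ((StdForm.antidiagonal 3).over K))).subgroupOf ((glInt 3 K).subgroupOf (unitaryGroupOfForm σ ((StdForm.antidiagonal 3).over K)))))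
        (⟨(r x.1)⁻¹ * γ * r x.1, inv_mul_mul_mem_of_smul_eq r hr γ x.2⟩ : ↥((glInt 3 K).subgroupOf (unitaryGroupOfForm σ ((StdForm.antidiagonal 3).over K)))))]
    {e a b c : K} (h2 : Valued.v (2 : K) = 1) (h2e : 2 * e = 1) (ha : σ a * a = 1) (hb : σ b * b = 1) (hc : σ c * c = 1)
    (hab : Valued.v (a - b) = 1) (hac : Valued.v (a - c) = 1) (hbc : Valued.v (b - c) = 1)
    (hγ : ((γ : GL (Fin 3) K) : Matrix (Fin 3) (Fin 3) K) = !![e * (a + c), 0, -(e * (a - c)); 0, b, 0; -(e * (a - c)), 0, e * (a + c)]) :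
    Nat.card (fixedBy (↥(unitaryGroupOfForm σ ((StdForm.antidiagonal 3).over K)) ⧸ (glInt 3 K).subgroupOf (unitaryGroupOfForm σ ((StdForm.antidiagonal 3).over K))) γ) = 1 ∧
      Nat.card (fixedBy (↥(unitaryGroupOfForm σ ((StdForm.antidiagonal 3).over K)) ⧸ ((glInt 3 K).map (MulAut.conj g₁).toMonoidHom).subgroupOf (unitaryGroupOfForm σ ((StdForm.antidiagonal 3).over K))) γ) = 0 := by
  classical
  have hχ : ((!![e * (a + c), 0, -(e * (a - c)); 0, b, 0; -(e * (a - c)), 0, e * (a + c)] : Matrix (Fin 3) (Fin 3) K)).charpoly = (X - C a) * (X - C b) * (X - C c) := by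
    simpa only [mul_one] using charpoly_flickerTorusElt (θ := (1 : K)) (θ' := 1) (a := a) (b := b) (c := c) h2e (mul_one 1)
  rw [← hγ] at hχ
  have h1 := natCard_fixedBy_special_add_eq_one_of_residually_separated hd g₁ hg₁ γ hK₁fin horb r hr ![a, b, c]
    (flickerLiteral_normOne_letters σ ha hb hc) ((flickerLiteral_separated_letters_iff a b c).2 ⟨hab, hac, hbc⟩)
    (fun i => flickerLiteral_charpoly_letter_separated hχ i)
  haveI : Nonempty (fixedBy (↥(unitaryGroupOfForm σ ((StdForm.antidiagonal 3).over K)) ⧸ (glInt 3 K).subgroupOf (unitaryGroupOfForm σ ((StdForm.antidiagonal 3).over K))) γ) :=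
    ⟨⟨_, flickerFrame_one_mem_fixedBy hd.vσ h2 h2e ha hb hc γ hγ⟩⟩
  have h0 : 0 < Nat.card (fixedBy (↥(unitaryGroupOfForm σ ((StdForm.antidiagonal 3).over K)) ⧸ (glInt 3 K).subgroupOf (unitaryGroupOfForm σ ((StdForm.antidiagonal 3).over K))) γ) := Nat.card_pos
  omega

-- the quotient-action instances `MulAction ↥K₀ (↥K₀ ⧸ I.subgroupOf K₀)` inside the ★ rung's binders exceed the default synthesis budget (same options as the ★ rung file)
set_option synthInstance.maxHeartbeats 400000 in
set_option maxHeartbeats 1600000 in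
/-- **`(V_hyp, V_sp)(t_ϖ(a,b,c)) = (0, 1)` IN REGIME R-III.**  Same letters, for the literal `γ = t_ϖ(a,b,c)`: `#Fix_γ(U ⧸ K₀) = 0` and `#Fix_γ(U ⧸ K₁) = 1` — the rung gives
`a₁ + a₀ = 1` and the special coset `w₀·K₁` is fixed (`flickerFrame_weyl_mem_fixedBy` at ★ `weylLongU`).  The literals `t₃ = t_ϖ(a,c,b)`, `t₄ = t_ϖ(b,a,c)` are this head with the
letters permuted. [cite: Flicker1998UnitaryFL, §2 Prop. 3 pp. 78–79; §3 p. 80] [cite: Kottwitz1986BaseChangeUnits, §1 p. 241] [cite: Serre1980Trees, II.1.1] -/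
theorem flickerFrame_natCard_fixedBy_pi_of_separated
    {σ : K →+* K} {ϖ : K} (hd : UnramifiedLocalConjDatum σ ϖ)
    (g₁ : GL (Fin 3) K) (hg₁ : (g₁ : Matrix (Fin 3) (Fin 3) K) = Matrix.diagonal ![(1 : K), 1, ϖ])
    (γ : ↥(unitaryGroupOfForm σ ((StdForm.antidiagonal 3).over K)))
    [Fintype (fixedBy (↥(unitaryGroupOfForm σ ((StdForm.antidiagonal 3).over K)) ⧸ (glInt 3 K).subgroupOf (unitaryGroupOfForm σ ((StdForm.antidiagonal 3).over K))) γ)]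
    (hK₁fin : (fixedBy (↥(unitaryGroupOfForm σ ((StdForm.antidiagonal 3).over K)) ⧸ ((glInt 3 K).map (MulAut.conj g₁).toMonoidHom).subgroupOf (unitaryGroupOfForm σ ((StdForm.antidiagonal 3).over K))) γ).Finite)
    (horb : (Set.range fun n : ℕ => ((γ ^ n : ↥(unitaryGroupOfForm σ ((StdForm.antidiagonal 3).over K))) : ↥(unitaryGroupOfForm σ ((StdForm.antidiagonal 3).over K)) ⧸ (glInt 3 K).subgroupOf (unitaryGroupOfForm σ ((StdForm.antidiagonal 3).over K)))).Finite)
    (r : ↥(unitaryGroupOfForm σ ((StdForm.antidiagonal 3).over K)) ⧸ (glInt 3 K).subgroupOf (unitaryGroupOfForm σ ((StdForm.antidiagonal 3).over K)) → ↥(unitaryGroupOfForm σ ((StdForm.antidiagonal 3).over K)))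
    (hr : Function.RightInverse r QuotientGroup.mk)
    [∀ x : fixedBy (↥(unitaryGroupOfForm σ ((StdForm.antidiagonal 3).over K)) ⧸ (glInt 3 K).subgroupOf (unitaryGroupOfForm σ ((StdForm.antidiagonal 3).over K))) γ,
      Finite (fixedBy (↥((glInt 3 K).subgroupOf (unitaryGroupOfForm σ ((StdForm.antidiagonal 3).over K))) ⧸
        (((glInt 3 K).subgroupOf (unitaryGroupOfForm σ ((StdForm.antidiagonal 3).over K)) ⊓ ((glInt 3 K).map (MulAut.conj g₁).toMonoidHom).subgroupOf (unitaryGroupOfForm σ ((StdForm.antidiagonal 3).over K))).subgroupOf ((glInt 3 K).subgroupOf (unitaryGroupOfForm σ ((StdForm.antidiagonal 3).over K)))))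
        (⟨(r x.1)⁻¹ * γ * r x.1, inv_mul_mul_mem_of_smul_eq r hr γ x.2⟩ : ↥((glInt 3 K).subgroupOf (unitaryGroupOfForm σ ((StdForm.antidiagonal 3).over K)))))]
    {e a b c : K} (h2 : Valued.v (2 : K) = 1) (h2e : 2 * e = 1) (ha : σ a * a = 1) (hb : σ b * b = 1) (hc : σ c * c = 1)
    (hab : Valued.v (a - b) = 1) (hac : Valued.v (a - c) = 1) (hbc : Valued.v (b - c) = 1)
    (hγ : ((γ : GL (Fin 3) K) : Matrix (Fin 3) (Fin 3) K) = !![e * (a + c), 0, -(e * (a - c) * ϖ); 0, b, 0; -(e * (a - c) * ϖ⁻¹), 0, e * (a + c)]) :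
    Nat.card (fixedBy (↥(unitaryGroupOfForm σ ((StdForm.antidiagonal 3).over K)) ⧸ (glInt 3 K).subgroupOf (unitaryGroupOfForm σ ((StdForm.antidiagonal 3).over K))) γ) = 0 ∧
      Nat.card (fixedBy (↥(unitaryGroupOfForm σ ((StdForm.antidiagonal 3).over K)) ⧸ ((glInt 3 K).map (MulAut.conj g₁).toMonoidHom).subgroupOf (unitaryGroupOfForm σ ((StdForm.antidiagonal 3).over K))) γ) = 1 := by
  classical
  have hϖ0 : ϖ ≠ 0 := CartanUnique.uniformizer_ne_zero hd.vϖ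
  have hχ : ((!![e * (a + c), 0, -(e * (a - c) * ϖ); 0, b, 0; -(e * (a - c) * ϖ⁻¹), 0, e * (a + c)] : Matrix (Fin 3) (Fin 3) K)).charpoly =
      (X - C a) * (X - C b) * (X - C c) := charpoly_flickerTorusElt h2e (mul_inv_cancel₀ hϖ0)
  rw [← hγ] at hχ
  have h1 := natCard_fixedBy_special_add_eq_one_of_residually_separated hd g₁ hg₁ γ hK₁fin horb r hr ![a, b, c]
    (flickerLiteral_normOne_letters σ ha hb hc) ((flickerLiteral_separated_letters_iff a b c).2 ⟨hab, hac, hbc⟩)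
    (fun i => flickerLiteral_charpoly_letter_separated hχ i)
  haveI : Nonempty (fixedBy (↥(unitaryGroupOfForm σ ((StdForm.antidiagonal 3).over K)) ⧸ ((glInt 3 K).map (MulAut.conj g₁).toMonoidHom).subgroupOf (unitaryGroupOfForm σ ((StdForm.antidiagonal 3).over K))) γ) :=
    ⟨⟨_, flickerFrame_weyl_mem_fixedBy hd.vσ h2 h2e hϖ0 ha hb hc g₁ hg₁ (weylLongU σ rfl) (coe_coe_weylLongU_three σ rfl) γ hγ⟩⟩
  haveI : Finite (fixedBy (↥(unitaryGroupOfForm σ ((StdForm.antidiagonal 3).over K)) ⧸ ((glInt 3 K).map (MulAut.conj g₁).toMonoidHom).subgroupOf (unitaryGroupOfForm σ ((StdForm.antidiagonal 3).over K))) γ) := hK₁fin.to_subtype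
  have h0 : 0 < Nat.card (fixedBy (↥(unitaryGroupOfForm σ ((StdForm.antidiagonal 3).over K)) ⧸ ((glInt 3 K).map (MulAut.conj g₁).toMonoidHom).subgroupOf (unitaryGroupOfForm σ ((StdForm.antidiagonal 3).over K))) γ) := Nat.card_pos
  omega


end Summit.HodgeConjecture.HodgeConjecture.R90.S6

end
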